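import Literature.AnabelianGeometry.EtaleTheta.ThetaSettingToZHat
import Literature.AnabelianGeometry.AbsoluteAnabelian.ZHatCompletionAdicCompleteness
import HarnessLib

/-!
# `Ẑ`-powers in profinite groups: `m^â` (`â ∈ Ẑ`), and the continuous endomorphisms `m ↦ m^â` of a profinite
# ABELIAN group — the topological `Ẑ`-module structure (support file for [EtTh] Rmk. 1.6.4 (c2), `a ∈ Ẑ` form)

Ribes–Zalesskii, *Profinite Groups* (2nd ed., 2010), §4.1 "Powers of elements with exponents from `Ẑ`": for a profinite
group `M` and `m ∈ M` the homomorphism `ℤ → M`, `n ↦ mⁿ` extends uniquely to a continuous homomorphism `Ẑ → M`,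
`â ↦ m^â`, and `(m, â) ↦ m^â` is continuous [cite: RibesZalesskii2010, §4.1].  Used for S. Mochizuki, *The Étale Theta
Function …* [EtTh], Publ. RIMS **45** (2009), Remark 1.6.4 p. 252: «on which any `Π_X/Π_{Y^∧} ≅ Ẑ ∋ a` acts via
`(η̈^Θ)^∧ ↦ (η̈^Θ)^∧ − 2a·log(Ü) − (a²/2)·log(q_X) + log(O^×_K̈)`» [cite: MochizukiEtTh2009, Rmk 1.6.4 p.26] — the
`Ẑ`-multiples `2a·log(Ü)`, `a²·log(q̈)` of classes with PROFINITE coefficients `Δ_Θ ≅ Ẑ(1)` need exactly this structure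
on the coefficient group (abc-iut VNEXT «RMK164-(c2)-ZHAT» piece (Z3), abc-iut-L2-lead gen 9 R1364; sequel file
`ContH1ZHatPow.lean` lifts it to `ContH1` via abc-iut-L2-t6's `ContH1.mapEndo`).

abc-iut cell, layer L2, seat abc-iut-L2-t12 gen 12.  GENERIC over Mathlib + the tree's `Ẑ` (`ThetaSetting.ZHat` =
`ProfiniteGrp.ProfiniteCompletion.completion (GrpCat.of (Multiplicative ℤ))`, `ThetaSetting.etaZ : ℤ → Ẑ`,
`ThetaSetting.isProfiniteCompletion_etaZ`) and abc-iut-f-142's universal-property API `IsProfiniteCompletion.lift` /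
`lift_ι` / `lift_unique` (p509804), all BY NAME.  `Ẑ` is written MULTIPLICATIVELY (so `â * b̂` is the SUM of exponents and
`1 : Ẑ` the zero exponent).  Contents:

* §1 (any profinite group `M`): **`powZHat m : Ẑ →ₜ* M`**, `â ↦ m^â` — THE continuous homomorphism with `η(n) ↦ mⁿ`
  (`powZHat_etaZ`, `powZHat_unique`); `map_powZHat` (every continuous homomorphism commutes with `Ẑ`-powers);
  `powZHat_mem_of_isClosed` (`m ∈ U` closed subgroup ⇒ `m^â ∈ U`); `powZHat_one_left`; the iterated power
  `powZHat_powZHat : (m^â)^b̂ = m^(â ⋆ b̂)` with `â ⋆ b̂ := powZHat â b̂ ∈ Ẑ` (the ring product of `Ẑ`, realised as the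
  `Ẑ`-power structure of `Ẑ` on itself — no ring instance is introduced);
* §2 (profinite ABELIAN `M`): `powZHat_mul_left : (m₁m₂)^â = m₁^â m₂^â`, **`zhatPow â : M →ₜ* M`**, `m ↦ m^â` — a
  CONTINUOUS endomorphism (continuity at `1` from the open-subgroup basis: `m ∈ N ⇒ m^â ∈ N`), with `zhatPow_etaZ`
  (agreement with `ℤ`-powers), `zhatPow_mul` (`m^(â*b̂) = m^â · m^b̂`), `zhatPow_one`, `zhatPow_inv`, `map_zhatPow`,
  `zhatPow_comp` (`(m^â)^b̂ = m^(â ⋆ b̂)`).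

DEF-BEARING (TWO defs: `powZHat`, `zhatPow`); no `instance`, no notation, no `Prop`-fact; classical and undisputed;
nothing of [EtTh] is asserted; no side is taken on [IUTchIII] Cor. 3.12; nothing here asserts that abc is proved or refuted.
-/

noncomputable section

namespace Literature.AnabelianGeometry.EtaleTheta

open Topology
open Literature.AnabelianGeometry.SemiGraphs

namespace ProfiniteZHatPow

universe u v

/-! ### §1. `m^â` in any profinite group -/

section Group

variable {M : Type u} [Group M] [TopologicalSpace M] [IsTopologicalGroup M] [CompactSpace M]
  [TotallyDisconnectedSpace M]

/-- **`m^â` (`â ∈ Ẑ`)**: the continuous homomorphism `Ẑ → M` extending `n ↦ mⁿ` (out of the DISCRETE group `ℤ`)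
along `η : ℤ → Ẑ` (abc-iut-f-142's `IsProfiniteCompletion.lift` at `isProfiniteCompletion_etaZ`).
[cite: RibesZalesskii2010, §4.1] -/
def powZHat (m : M) : ThetaSetting.ZHat →ₜ* M :=
  ThetaSetting.isProfiniteCompletion_etaZ.lift
    { toMonoidHom := zpowersHom M m, continuous_toFun := continuous_of_discreteTopology }

/-- `m^{η n} = mⁿ`. [cite: RibesZalesskii2010, §4.1] -/
theorem powZHat_etaZ (m : M) (n : Multiplicative ℤ) : powZHat m (ThetaSetting.etaZ n) = m ^ n.toAdd :=
  ThetaSetting.isProfiniteCompletion_etaZ.lift_ι _ n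

/-- `m^{η 1} = m`. [cite: RibesZalesskii2010, §4.1] -/
theorem powZHat_etaZ_one (m : M) : powZHat m (ThetaSetting.etaZ (Multiplicative.ofAdd 1)) = m := by
  rw [powZHat_etaZ, toAdd_ofAdd, zpow_one]

/-- **Uniqueness**: a continuous homomorphism `Ẑ → M` with `η 1 ↦ m` IS `powZHat m` (`η(ℤ)` is dense, `M` Hausdorff).
[cite: RibesZalesskii2010, §4.1] -/
theorem powZHat_unique (m : M) (Φ : ThetaSetting.ZHat →ₜ* M) (h : Φ (ThetaSetting.etaZ (Multiplicative.ofAdd 1)) = m) :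
    Φ = powZHat m := by
  refine ThetaSetting.isProfiniteCompletion_etaZ.lift_unique _ Φ fun n => ?_
  have hn : n = Multiplicative.ofAdd 1 ^ n.toAdd := by
    rw [← ofAdd_zsmul, smul_eq_mul, mul_one, ofAdd_toAdd]
  change _ = m ^ n.toAdd
  conv_lhs => rw [hn, map_zpow, map_zpow, h]

/-- Two continuous homomorphisms `Ẑ → M` agreeing at `η 1` are equal. [cite: RibesZalesskii2010, §4.1] -/
theorem ext_etaZ_one (Φ Ψ : ThetaSetting.ZHat →ₜ* M)
    (h : Φ (ThetaSetting.etaZ (Multiplicative.ofAdd 1)) = Ψ (ThetaSetting.etaZ (Multiplicative.ofAdd 1))) : Φ = Ψ := by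
  rw [powZHat_unique _ Φ h, ← powZHat_unique _ Ψ rfl]

/-- `1^â = 1`. [cite: RibesZalesskii2010, §4.1] -/
theorem powZHat_one_left (a : ThetaSetting.ZHat) : powZHat (1 : M) a = 1 := by
  have h : (1 : ThetaSetting.ZHat →ₜ* M) = powZHat 1 := powZHat_unique (1 : M) 1 rfl
  rw [← h]
  rfl

/-- **Every continuous homomorphism commutes with `Ẑ`-powers**: `F (m^â) = (F m)^â`. [cite: RibesZalesskii2010, §4.1] -/
theorem map_powZHat {M' : Type v} [Group M'] [TopologicalSpace M'] [IsTopologicalGroup M'] [CompactSpace M']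
    [TotallyDisconnectedSpace M'] (F : M →ₜ* M') (m : M) (a : ThetaSetting.ZHat) :
    F (powZHat m a) = powZHat (F m) a := by
  have h : F.comp (powZHat m) = powZHat (F m) :=
    powZHat_unique (F m) _ (by rw [ContinuousMonoidHom.comp_toFun, powZHat_etaZ_one])
  exact DFunLike.congr_fun h a

/-- `m^â` lies in every CLOSED subgroup containing `m` (the powers `mⁿ` do, and they are dense in the image).
[cite: RibesZalesskii2010, §4.1] -/
theorem powZHat_mem_of_isClosed {U : Subgroup M} (hU : IsClosed (U : Set M)) {m : M} (hm : m ∈ U)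
    (a : ThetaSetting.ZHat) : powZHat m a ∈ U := by
  have hsub : Set.range (ThetaSetting.etaZ : Multiplicative ℤ → ThetaSetting.ZHat) ⊆ powZHat m ⁻¹' (U : Set M) := by
    rintro _ ⟨n, rfl⟩
    rw [Set.mem_preimage, SetLike.mem_coe, powZHat_etaZ]
    exact U.zpow_mem hm _
  have hcl : closure (Set.range (ThetaSetting.etaZ : Multiplicative ℤ → ThetaSetting.ZHat)) ⊆ powZHat m ⁻¹' (U : Set M) :=
    closure_minimal hsub (hU.preimage (powZHat m).continuous)
  have ha : a ∈ closure (Set.range (ThetaSetting.etaZ : Multiplicative ℤ → ThetaSetting.ZHat)) := by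
    rw [ThetaSetting.isProfiniteCompletion_etaZ.denseRange.closure_range]
    exact Set.mem_univ _
  exact hcl ha

/-- **Iterated powers**: `(m^â)^b̂ = m^(â ⋆ b̂)` where `â ⋆ b̂ := powZHat â b̂ ∈ Ẑ` is the `Ẑ`-power of `â` by `b̂` in the
profinite group `Ẑ` itself (= the ring product of `Ẑ`; both sides are continuous homomorphisms in `b̂` agreeing at `η 1`).
[cite: RibesZalesskii2010, §4.1] -/
theorem powZHat_powZHat (m : M) (a b : ThetaSetting.ZHat) :
    powZHat (powZHat m a) b = powZHat m (powZHat a b) := by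
  have h : powZHat (powZHat m a) = (powZHat m).comp (powZHat a) := by
    symm
    refine powZHat_unique _ _ ?_
    rw [ContinuousMonoidHom.comp_toFun, powZHat_etaZ_one]
  exact DFunLike.congr_fun h b

/-- `â ⋆ η(n) = â^n`: the `Ẑ`-product with an integer is the integer power. [cite: RibesZalesskii2010, §4.1] -/
theorem powZHat_self_etaZ (a : ThetaSetting.ZHat) (n : Multiplicative ℤ) :
    powZHat a (ThetaSetting.etaZ n) = a ^ n.toAdd :=
  powZHat_etaZ a n

/-- `η(k) ⋆ b̂ = b̂^k` (so `⋆` restricted to `η(ℤ) × η(ℤ)` is the product of integers: `η(k) ⋆ η(n) = η(kn)`).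
[cite: RibesZalesskii2010, §4.1] -/
theorem powZHat_etaZ_left (k : Multiplicative ℤ) (b : ThetaSetting.ZHat) :
    powZHat (ThetaSetting.etaZ k) b = b ^ k.toAdd := by
  let Ψ : ThetaSetting.ZHat →ₜ* ThetaSetting.ZHat :=
    { toFun := fun b => b ^ k.toAdd
      map_one' := one_zpow _
      map_mul' := fun x y =>
        (show Commute x y from Literature.AnabelianGeometry.AbsoluteAnabelian.ZHatCompletion.mul_comm x y).mul_zpow _
      continuous_toFun := continuous_zpow k.toAdd }
  have h : Ψ = powZHat (ThetaSetting.etaZ k) := powZHat_unique _ Ψ (by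
    change ThetaSetting.etaZ (Multiplicative.ofAdd 1) ^ k.toAdd = ThetaSetting.etaZ k
    rw [← map_zpow, ← ofAdd_zsmul, smul_eq_mul, mul_one, ofAdd_toAdd])
  exact (DFunLike.congr_fun h b).symm

/-- **Distributivity of the `Ẑ`-product over the group law in the LEFT factor**: `(â * ĉ) ⋆ b̂ = (â ⋆ b̂) * (ĉ ⋆ b̂)`
(`Ẑ` is commutative — the tree's theorem `ZHatCompletion.mul_comm`, no instance — so the pointwise product of the two
one-parameter groups is a one-parameter group; uniqueness at `η 1`).  Right distributivity `â ⋆ (b̂ * ĉ) = (â ⋆ b̂) * (â ⋆ ĉ)`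
is `map_mul (powZHat â)`. [cite: RibesZalesskii2010, §4.1] -/
theorem powZHat_mul_left_zhat (a c b : ThetaSetting.ZHat) : powZHat (a * c) b = powZHat a b * powZHat c b := by
  let Ψ : ThetaSetting.ZHat →ₜ* ThetaSetting.ZHat :=
    { toFun := fun x => powZHat a x * powZHat c x
      map_one' := by rw [map_one, map_one, mul_one]
      map_mul' := fun x y => by
        rw [map_mul, map_mul, mul_assoc, mul_assoc,
          ← mul_assoc (powZHat a y), Literature.AnabelianGeometry.AbsoluteAnabelian.ZHatCompletion.mul_comm (powZHat a y),
          mul_assoc]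
      continuous_toFun := (powZHat a).continuous.mul (powZHat c).continuous }
  have h : Ψ = powZHat (a * c) := powZHat_unique _ Ψ (by
    change powZHat a _ * powZHat c _ = a * c
    rw [powZHat_etaZ_one, powZHat_etaZ_one])
  exact (DFunLike.congr_fun h b).symm

/-- `η(k) ⋆ η(n) = η(k·n)`. [cite: RibesZalesskii2010, §4.1] -/
theorem powZHat_etaZ_etaZ (k n : ℤ) :
    powZHat (ThetaSetting.etaZ (Multiplicative.ofAdd k)) (ThetaSetting.etaZ (Multiplicative.ofAdd n)) =
      ThetaSetting.etaZ (Multiplicative.ofAdd (k * n)) := by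
  rw [powZHat_etaZ, toAdd_ofAdd, ← map_zpow, ← ofAdd_zsmul, smul_eq_mul, mul_comm]

end Group

/-! ### §2. Profinite ABELIAN groups: the continuous endomorphisms `m ↦ m^â` -/

section CommGroup

variable {M : Type u} [CommGroup M] [TopologicalSpace M] [IsTopologicalGroup M] [CompactSpace M]
  [TotallyDisconnectedSpace M]

/-- **`(m₁ m₂)^â = m₁^â m₂^â`** in a profinite abelian group (both sides are continuous homomorphisms in `â` agreeing at
`η 1`). [cite: RibesZalesskii2010, §4.1] -/
theorem powZHat_mul_left (m₁ m₂ : M) (a : ThetaSetting.ZHat) :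
    powZHat (m₁ * m₂) a = powZHat m₁ a * powZHat m₂ a := by
  have h : powZHat m₁ * powZHat m₂ = powZHat (m₁ * m₂) :=
    powZHat_unique _ _ (by
      change powZHat m₁ _ * powZHat m₂ _ = m₁ * m₂
      rw [powZHat_etaZ_one, powZHat_etaZ_one])
  exact (DFunLike.congr_fun h a).symm

/-- `(m⁻¹)^â = (m^â)⁻¹`. [cite: RibesZalesskii2010, §4.1] -/
theorem powZHat_inv_left (m : M) (a : ThetaSetting.ZHat) : powZHat m⁻¹ a = (powZHat m a)⁻¹ :=
  eq_inv_of_mul_eq_one_left (by rw [← powZHat_mul_left, inv_mul_cancel, powZHat_one_left])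

/-- **`m ↦ m^â` is CONTINUOUS** on a profinite abelian group: it is a homomorphism (`powZHat_mul_left`) mapping every
open (hence closed) subgroup into itself (`powZHat_mem_of_isClosed`), and the open normal subgroups form a basis of
neighbourhoods of `1` (`ProfiniteGrp.exist_openNormalSubgroup_sub_open_nhds_of_one`). [cite: RibesZalesskii2010, §4.1] -/
theorem continuous_powZHat_left (a : ThetaSetting.ZHat) : Continuous fun m : M => powZHat m a := by
  let F : M →* M :=
    { toFun := fun m => powZHat m a, map_one' := powZHat_one_left a, map_mul' := fun m₁ m₂ => powZHat_mul_left m₁ m₂ a }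
  refine continuous_of_continuousAt_one F ?_
  rw [ContinuousAt, map_one]
  intro W hW
  obtain ⟨U, hUW, hUo, h1U⟩ := mem_nhds_iff.mp hW
  obtain ⟨N, hN⟩ := ProfiniteGrp.exist_openNormalSubgroup_sub_open_nhds_of_one hUo h1U
  rw [Filter.mem_map]
  refine Filter.mem_of_superset (N.toOpenSubgroup.isOpen.mem_nhds N.toOpenSubgroup.one_mem) fun m hm => ?_
  exact hUW (hN (powZHat_mem_of_isClosed N.toOpenSubgroup.isClosed hm a))

/-- **`zhatPow â : M →ₜ* M`, `m ↦ m^â`** — the continuous endomorphism of the profinite abelian group `M` given by an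
element `â ∈ Ẑ` (the topological `Ẑ`-module structure). [cite: RibesZalesskii2010, §4.1] -/
def zhatPow (a : ThetaSetting.ZHat) : M →ₜ* M where
  toFun m := powZHat m a
  map_one' := powZHat_one_left a
  map_mul' m₁ m₂ := powZHat_mul_left m₁ m₂ a
  continuous_toFun := continuous_powZHat_left a

/-- `zhatPow â m = m^â`. [cite: RibesZalesskii2010, §4.1] -/
theorem zhatPow_apply (a : ThetaSetting.ZHat) (m : M) : zhatPow a m = powZHat m a := rfl

/-- **Agreement with `ℤ`-powers**: `m^{η n} = mⁿ`. [cite: RibesZalesskii2010, §4.1] -/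
theorem zhatPow_etaZ (n : Multiplicative ℤ) (m : M) : zhatPow (ThetaSetting.etaZ n) m = m ^ n.toAdd :=
  powZHat_etaZ m n

/-- `m^{η 1} = m`: `zhatPow (η 1)` is the identity. [cite: RibesZalesskii2010, §4.1] -/
theorem zhatPow_etaZ_one (m : M) : zhatPow (ThetaSetting.etaZ (Multiplicative.ofAdd 1)) m = m :=
  powZHat_etaZ_one m

/-- **Additivity in the exponent** (`Ẑ` written multiplicatively): `m^(â*b̂) = m^â · m^b̂`. [cite: RibesZalesskii2010, §4.1] -/
theorem zhatPow_mul (a b : ThetaSetting.ZHat) (m : M) : zhatPow (a * b) m = zhatPow a m * zhatPow b m :=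
  map_mul (powZHat m) a b

/-- `m^0 = 1` (the zero exponent is `1 : Ẑ`). [cite: RibesZalesskii2010, §4.1] -/
theorem zhatPow_one (m : M) : zhatPow (1 : ThetaSetting.ZHat) m = 1 := map_one (powZHat m)

/-- `m^(â⁻¹) = (m^â)⁻¹` (negated exponent). [cite: RibesZalesskii2010, §4.1] -/
theorem zhatPow_inv (a : ThetaSetting.ZHat) (m : M) : zhatPow a⁻¹ m = (zhatPow a m)⁻¹ := map_inv (powZHat m) a

/-- `(m₁m₂)^â = m₁^â m₂^â`, `(m⁻¹)^â = (m^â)⁻¹`: `zhatPow â` is a group homomorphism (restated pointwise).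
[cite: RibesZalesskii2010, §4.1] -/
theorem zhatPow_mul_left (a : ThetaSetting.ZHat) (m₁ m₂ : M) : zhatPow a (m₁ * m₂) = zhatPow a m₁ * zhatPow a m₂ :=
  map_mul (zhatPow a) m₁ m₂

/-- **Every continuous homomorphism of profinite abelian groups is `Ẑ`-linear**: `F (m^â) = (F m)^â`.
[cite: RibesZalesskii2010, §4.1] -/
theorem map_zhatPow {M' : Type v} [CommGroup M'] [TopologicalSpace M'] [IsTopologicalGroup M'] [CompactSpace M']
    [TotallyDisconnectedSpace M'] (F : M →ₜ* M') (a : ThetaSetting.ZHat) (m : M) :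
    F (zhatPow a m) = zhatPow a (F m) :=
  map_powZHat F m a

/-- A continuous homomorphism INTO a profinite abelian group from any profinite group is `Ẑ`-linear:
`F (g^â) = (F g)^â`. [cite: RibesZalesskii2010, §4.1] -/
theorem map_powZHat_eq_zhatPow {P : Type v} [Group P] [TopologicalSpace P] [IsTopologicalGroup P] [CompactSpace P]
    [TotallyDisconnectedSpace P] (F : P →ₜ* M) (g : P) (a : ThetaSetting.ZHat) :
    F (powZHat g a) = zhatPow a (F g) :=
  map_powZHat F g a

/-- **Iterated powers**: `(m^â)^b̂ = m^(â ⋆ b̂)` with `â ⋆ b̂ = powZHat â b̂` the product of `Ẑ`. [cite: RibesZalesskii2010, §4.1] -/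
theorem zhatPow_zhatPow (a b : ThetaSetting.ZHat) (m : M) : zhatPow b (zhatPow a m) = zhatPow (powZHat a b) m :=
  powZHat_powZHat m a b

/-- `zhatPow b̂ ∘ zhatPow â = zhatPow (â ⋆ b̂)` as continuous endomorphisms. [cite: RibesZalesskii2010, §4.1] -/
theorem zhatPow_comp (a b : ThetaSetting.ZHat) :
    (zhatPow (M := M) b).comp (zhatPow a) = zhatPow (powZHat a b) :=
  ContinuousMonoidHom.ext fun m => zhatPow_zhatPow a b m

/-- `m^â` stays in every closed subgroup containing `m` (pointwise form for `zhatPow`). [cite: RibesZalesskii2010, §4.1] -/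
theorem zhatPow_mem_of_isClosed {U : Subgroup M} (hU : IsClosed (U : Set M)) (a : ThetaSetting.ZHat) {m : M}
    (hm : m ∈ U) : zhatPow a m ∈ U :=
  powZHat_mem_of_isClosed hU hm a

/-- `Ẑ`-powers preserve `n`-th powers: `(mⁿ)^â = (m^â)ⁿ`. [cite: RibesZalesskii2010, §4.1] -/
theorem zhatPow_pow (a : ThetaSetting.ZHat) (m : M) (n : ℕ) : zhatPow a (m ^ n) = zhatPow a m ^ n :=
  map_pow (zhatPow a) m n

/-- `Ẑ`-powers preserve integer powers: `(m^k)^â = (m^â)^k`. [cite: RibesZalesskii2010, §4.1] -/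
theorem zhatPow_zpow (a : ThetaSetting.ZHat) (m : M) (k : ℤ) : zhatPow a (m ^ k) = zhatPow a m ^ k :=
  map_zpow (zhatPow a) m k

end CommGroup

end ProfiniteZHatPow

end Literature.AnabelianGeometry.EtaleTheta

end
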